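import Summits.Ventures.CertifiedArithmetic.LowPrec.GemmThetaE4M3E5M2Cover
import Summits.Ventures.CertifiedArithmetic.LowPrec.GemmFreeMoves
import Summits.Ventures.CertifiedArithmetic.LowPrec.GemmThetaE4M3E5M2Check01
import Summits.Ventures.CertifiedArithmetic.LowPrec.GemmThetaE4M3E5M2Check02
import Summits.Ventures.CertifiedArithmetic.LowPrec.GemmThetaE4M3E5M2Check03
import Summits.Ventures.CertifiedArithmetic.LowPrec.GemmThetaE4M3E5M2Check04
import Summits.Ventures.CertifiedArithmetic.LowPrec.GemmThetaE4M3E5M2Check05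
import Summits.Ventures.CertifiedArithmetic.LowPrec.GemmThetaE4M3E5M2Check06
import Summits.Ventures.CertifiedArithmetic.LowPrec.GemmThetaE4M3E5M2Check07
import Summits.Ventures.CertifiedArithmetic.LowPrec.GemmThetaE4M3E5M2Check08
import Summits.Ventures.CertifiedArithmetic.LowPrec.GemmThetaE4M3E5M2Check09
import Summits.Ventures.CertifiedArithmetic.LowPrec.GemmThetaE4M3E5M2Check10
import Summits.Ventures.CertifiedArithmetic.LowPrec.GemmThetaE4M3E5M2Check11
import Summits.Ventures.CertifiedArithmetic.LowPrec.GemmThetaE4M3E5M2Check12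
import Summits.Ventures.CertifiedArithmetic.LowPrec.GemmThetaE4M3E5M2Check13
import Summits.Ventures.CertifiedArithmetic.LowPrec.GemmThetaE4M3E5M2Check14
import Summits.Ventures.CertifiedArithmetic.LowPrec.GemmThetaE4M3E5M2Check15
import Summits.Ventures.CertifiedArithmetic.LowPrec.GemmThetaE4M3E5M2Check16
import Summits.Ventures.CertifiedArithmetic.LowPrec.GemmThetaE4M3E5M2Check17
import Summits.Ventures.CertifiedArithmetic.LowPrec.GemmThetaE4M3E5M2Check18
import Summits.Ventures.CertifiedArithmetic.LowPrec.GemmThetaE4M3E5M2Check19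
import Summits.Ventures.CertifiedArithmetic.LowPrec.GemmThetaE4M3E5M2Check20
import Summits.Ventures.CertifiedArithmetic.LowPrec.GemmThetaE4M3E5M2Check21
import Summits.Ventures.CertifiedArithmetic.LowPrec.GemmThetaE4M3E5M2Check22
import Summits.Ventures.CertifiedArithmetic.LowPrec.GemmThetaE4M3E5M2Check23
import Summits.Ventures.CertifiedArithmetic.LowPrec.GemmThetaE4M3E5M2Check24
import Summits.Ventures.CertifiedArithmetic.LowPrec.GemmThetaE4M3E5M2Check25
import Summits.Ventures.CertifiedArithmetic.LowPrec.GemmThetaE4M3E5M2Check26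
import Summits.Ventures.CertifiedArithmetic.LowPrec.GemmThetaE4M3E5M2Check27
import Summits.Ventures.CertifiedArithmetic.LowPrec.GemmThetaE4M3E5M2Check28
import Summits.Ventures.CertifiedArithmetic.LowPrec.GemmThetaE4M3E5M2Check29
import Summits.Ventures.CertifiedArithmetic.LowPrec.GemmThetaE4M3E5M2Check30
import Summits.Ventures.CertifiedArithmetic.LowPrec.GemmThetaE4M3E5M2Check31
import Summits.Ventures.CertifiedArithmetic.LowPrec.GemmThetaE4M3E5M2Check32
import Summits.Ventures.CertifiedArithmetic.LowPrec.GemmThetaE4M3E5M2Check33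
import Summits.Ventures.CertifiedArithmetic.LowPrec.GemmThetaE4M3E5M2Check34
import Summits.Ventures.CertifiedArithmetic.LowPrec.GemmThetaE4M3E5M2Check35
import Summits.Ventures.CertifiedArithmetic.LowPrec.GemmThetaE4M3E5M2Check36

/-!
# The θ-certificate of E4M3·E5M2→bfloat16, assembled: `thetaCert_E4M3E5M2_BFloat16`

HONEST FRAMING (venture CertifiedArithmetic / cell `pub-lowprec`, seat gemm, gen 9): certified error
envelopes and provably optimal rounding/accumulation schemes for low-precision formats under stated
cost models; every table by two implementations; no hardware or vendor claims.

Paper `gemm.tex` §Regimes, Prop. "the terminal constant bounds the defect for every n" (i), instance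
OCP FP8 E4M3·E5M2 products ([MicikeviciusEtAl2022, Table 1]) accumulated sequentially in `bfloat16`
(RNE): the kernel-checked chunk theorems of `GemmThetaE4M3E5M2Check01..36.lean` cover all `2085`
letters (`cover_all`), so by the soundness of the compressed format (`GemmThetaE4M3E5M2Cover.lean`)
every one of the `2 · 6657 · 2085 = 27 759 690` edges of the reachable graph satisfies the `Facts`;
read through the dictionary `v = V/2^25` (bridge `GemmGridRounding120.lean`) they are the fields of
a `ThetaCertificate` (`GemmThetaCertificate.lean`) with `θ = 558345748481/2^38 ≈ 2.0313`,
`ρ = 63/2`, `κ = 1/θ` and the free-pair constant `β_pair = 193/2 = 2 + 3ρ` — the latter DERIVED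
(`free_pair_bound` + Lemma D `no_consecutive_free_moves` of `GemmFreeMoves.lean`: the move after a
free move is paid), not read off the cell certificate.  Same assembly as `GemmThetaE4M3.lean`.
-/

namespace Literature.ComputerArithmetic.FloatingPoint

namespace MiniFloat

open Finset ThetaE4M3E5M2

namespace ThetaE4M3E5M2

/-! ### Every letter is covered -/

/-- ALL `2085` LETTERS ARE COVERED (the chunk theorems, concatenated). [cell certificate,
kernel-checked] -/
theorem cover_all : CoverRange 0 2085 := by
  have h₁ : CoverRange 0 33 := coverRange_of_chunkOK chunk_0
  have h₂ : CoverRange 0 65 := coverRange_append (by norm_num) h₁ (coverRange_of_chunkOK chunk_33)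
  have h₃ : CoverRange 0 94 := coverRange_append (by norm_num) h₂ (coverRange_of_chunkOK chunk_65)
  have h₄ : CoverRange 0 123 := coverRange_append (by norm_num) h₃ (coverRange_of_chunkOK chunk_94)
  have h₅ : CoverRange 0 154 := coverRange_append (by norm_num) h₄ (coverRange_of_chunkOK chunk_123)
  have h₆ : CoverRange 0 184 := coverRange_append (by norm_num) h₅ (coverRange_of_chunkOK chunk_154)
  have h₇ : CoverRange 0 213 := coverRange_append (by norm_num) h₆ (coverRange_of_chunkOK chunk_184)
  have h₈ : CoverRange 0 242 := coverRange_append (by norm_num) h₇ (coverRange_of_chunkOK chunk_213)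
  have h₉ : CoverRange 0 274 := coverRange_append (by norm_num) h₈ (coverRange_of_chunkOK chunk_242)
  have h₁₀ : CoverRange 0 306 := coverRange_append (by norm_num) h₉ (coverRange_of_chunkOK chunk_274)
  have h₁₁ : CoverRange 0 337 := coverRange_append (by norm_num) h₁₀ (coverRange_of_chunkOK chunk_306)
  have h₁₂ : CoverRange 0 367 := coverRange_append (by norm_num) h₁₁ (coverRange_of_chunkOK chunk_337)
  have h₁₃ : CoverRange 0 396 := coverRange_append (by norm_num) h₁₂ (coverRange_of_chunkOK chunk_367)
  have h₁₄ : CoverRange 0 425 := coverRange_append (by norm_num) h₁₃ (coverRange_of_chunkOK chunk_396)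
  have h₁₅ : CoverRange 0 457 := coverRange_append (by norm_num) h₁₄ (coverRange_of_chunkOK chunk_425)
  have h₁₆ : CoverRange 0 489 := coverRange_append (by norm_num) h₁₅ (coverRange_of_chunkOK chunk_457)
  have h₁₇ : CoverRange 0 520 := coverRange_append (by norm_num) h₁₆ (coverRange_of_chunkOK chunk_489)
  have h₁₈ : CoverRange 0 550 := coverRange_append (by norm_num) h₁₇ (coverRange_of_chunkOK chunk_520)
  have h₁₉ : CoverRange 0 579 := coverRange_append (by norm_num) h₁₈ (coverRange_of_chunkOK chunk_550)
  have h₂₀ : CoverRange 0 608 := coverRange_append (by norm_num) h₁₉ (coverRange_of_chunkOK chunk_579)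
  have h₂₁ : CoverRange 0 640 := coverRange_append (by norm_num) h₂₀ (coverRange_of_chunkOK chunk_608)
  have h₂₂ : CoverRange 0 672 := coverRange_append (by norm_num) h₂₁ (coverRange_of_chunkOK chunk_640)
  have h₂₃ : CoverRange 0 703 := coverRange_append (by norm_num) h₂₂ (coverRange_of_chunkOK chunk_672)
  have h₂₄ : CoverRange 0 733 := coverRange_append (by norm_num) h₂₃ (coverRange_of_chunkOK chunk_703)
  have h₂₅ : CoverRange 0 762 := coverRange_append (by norm_num) h₂₄ (coverRange_of_chunkOK chunk_733)
  have h₂₆ : CoverRange 0 791 := coverRange_append (by norm_num) h₂₅ (coverRange_of_chunkOK chunk_762)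
  have h₂₇ : CoverRange 0 824 := coverRange_append (by norm_num) h₂₆ (coverRange_of_chunkOK chunk_791)
  have h₂₈ : CoverRange 0 856 := coverRange_append (by norm_num) h₂₇ (coverRange_of_chunkOK chunk_824)
  have h₂₉ : CoverRange 0 887 := coverRange_append (by norm_num) h₂₈ (coverRange_of_chunkOK chunk_856)
  have h₃₀ : CoverRange 0 917 := coverRange_append (by norm_num) h₂₉ (coverRange_of_chunkOK chunk_887)
  have h₃₁ : CoverRange 0 948 := coverRange_append (by norm_num) h₃₀ (coverRange_of_chunkOK chunk_917)
  have h₃₂ : CoverRange 0 978 := coverRange_append (by norm_num) h₃₁ (coverRange_of_chunkOK chunk_948)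
  have h₃₃ : CoverRange 0 1009 := coverRange_append (by norm_num) h₃₂ (coverRange_of_chunkOK chunk_978)
  have h₃₄ : CoverRange 0 1040 := coverRange_append (by norm_num) h₃₃ (coverRange_of_chunkOK chunk_1009)
  have h₃₅ : CoverRange 0 1064 := coverRange_append (by norm_num) h₃₄ (coverRange_of_chunkOK chunk_1040)
  have h₃₆ : CoverRange 0 1087 := coverRange_append (by norm_num) h₃₅ (coverRange_of_chunkOK chunk_1064)
  have h₃₇ : CoverRange 0 1112 := coverRange_append (by norm_num) h₃₆ (coverRange_of_chunkOK chunk_1087)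
  have h₃₈ : CoverRange 0 1136 := coverRange_append (by norm_num) h₃₇ (coverRange_of_chunkOK chunk_1112)
  have h₃₉ : CoverRange 0 1165 := coverRange_append (by norm_num) h₃₈ (coverRange_of_chunkOK chunk_1136)
  have h₄₀ : CoverRange 0 1194 := coverRange_append (by norm_num) h₃₉ (coverRange_of_chunkOK chunk_1165)
  have h₄₁ : CoverRange 0 1223 := coverRange_append (by norm_num) h₄₀ (coverRange_of_chunkOK chunk_1194)
  have h₄₂ : CoverRange 0 1251 := coverRange_append (by norm_num) h₄₁ (coverRange_of_chunkOK chunk_1223)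
  have h₄₃ : CoverRange 0 1282 := coverRange_append (by norm_num) h₄₂ (coverRange_of_chunkOK chunk_1251)
  have h₄₄ : CoverRange 0 1312 := coverRange_append (by norm_num) h₄₃ (coverRange_of_chunkOK chunk_1282)
  have h₄₅ : CoverRange 0 1341 := coverRange_append (by norm_num) h₄₄ (coverRange_of_chunkOK chunk_1312)
  have h₄₆ : CoverRange 0 1369 := coverRange_append (by norm_num) h₄₅ (coverRange_of_chunkOK chunk_1341)
  have h₄₇ : CoverRange 0 1401 := coverRange_append (by norm_num) h₄₆ (coverRange_of_chunkOK chunk_1369)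
  have h₄₈ : CoverRange 0 1432 := coverRange_append (by norm_num) h₄₇ (coverRange_of_chunkOK chunk_1401)
  have h₄₉ : CoverRange 0 1460 := coverRange_append (by norm_num) h₄₈ (coverRange_of_chunkOK chunk_1432)
  have h₅₀ : CoverRange 0 1488 := coverRange_append (by norm_num) h₄₉ (coverRange_of_chunkOK chunk_1460)
  have h₅₁ : CoverRange 0 1518 := coverRange_append (by norm_num) h₅₀ (coverRange_of_chunkOK chunk_1488)
  have h₅₂ : CoverRange 0 1547 := coverRange_append (by norm_num) h₅₁ (coverRange_of_chunkOK chunk_1518)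
  have h₅₃ : CoverRange 0 1575 := coverRange_append (by norm_num) h₅₂ (coverRange_of_chunkOK chunk_1547)
  have h₅₄ : CoverRange 0 1603 := coverRange_append (by norm_num) h₅₃ (coverRange_of_chunkOK chunk_1575)
  have h₅₅ : CoverRange 0 1633 := coverRange_append (by norm_num) h₅₄ (coverRange_of_chunkOK chunk_1603)
  have h₅₆ : CoverRange 0 1662 := coverRange_append (by norm_num) h₅₅ (coverRange_of_chunkOK chunk_1633)
  have h₅₇ : CoverRange 0 1690 := coverRange_append (by norm_num) h₅₆ (coverRange_of_chunkOK chunk_1662)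
  have h₅₈ : CoverRange 0 1718 := coverRange_append (by norm_num) h₅₇ (coverRange_of_chunkOK chunk_1690)
  have h₅₉ : CoverRange 0 1748 := coverRange_append (by norm_num) h₅₈ (coverRange_of_chunkOK chunk_1718)
  have h₆₀ : CoverRange 0 1777 := coverRange_append (by norm_num) h₅₉ (coverRange_of_chunkOK chunk_1748)
  have h₆₁ : CoverRange 0 1805 := coverRange_append (by norm_num) h₆₀ (coverRange_of_chunkOK chunk_1777)
  have h₆₂ : CoverRange 0 1833 := coverRange_append (by norm_num) h₆₁ (coverRange_of_chunkOK chunk_1805)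
  have h₆₃ : CoverRange 0 1863 := coverRange_append (by norm_num) h₆₂ (coverRange_of_chunkOK chunk_1833)
  have h₆₄ : CoverRange 0 1892 := coverRange_append (by norm_num) h₆₃ (coverRange_of_chunkOK chunk_1863)
  have h₆₅ : CoverRange 0 1920 := coverRange_append (by norm_num) h₆₄ (coverRange_of_chunkOK chunk_1892)
  have h₆₆ : CoverRange 0 1948 := coverRange_append (by norm_num) h₆₅ (coverRange_of_chunkOK chunk_1920)
  have h₆₇ : CoverRange 0 1978 := coverRange_append (by norm_num) h₆₆ (coverRange_of_chunkOK chunk_1948)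
  have h₆₈ : CoverRange 0 2007 := coverRange_append (by norm_num) h₆₇ (coverRange_of_chunkOK chunk_1978)
  have h₆₉ : CoverRange 0 2035 := coverRange_append (by norm_num) h₆₈ (coverRange_of_chunkOK chunk_2007)
  have h₇₀ : CoverRange 0 2063 := coverRange_append (by norm_num) h₆₉ (coverRange_of_chunkOK chunk_2035)
  have h₇₁ : CoverRange 0 2074 := coverRange_append (by norm_num) h₇₀ (coverRange_of_chunkOK chunk_2063)
  have h₇₂ : CoverRange 0 2085 := coverRange_append (by norm_num) h₇₁ (coverRange_of_chunkOK chunk_2074)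
  exact h₇₂

/-- THE FACTS OF EVERY EDGE `(σ, i) → Q` of the reachable graph. [cell certificate, kernel-checked] -/
theorem edge_facts (σ : Bool) {i : ℕ} (hi : i ≤ 6656) {Q : ℤ} (hQ : Q ∈ lamG) : Facts σ i Q :=
  facts_of_cover hQ (coverOK_of_range cover_all hQ) σ hi

/-! ### The dictionary in grid units `2^-25` -/

/-- The bridge applies to every edge: `|V + Q| < 2^120`. [cell] -/
theorem hb120 {Q : ℤ} (hQ : Q ∈ lamG) (σ : Bool) (i : ℕ) : (sval σ i + Q).natAbs < 2 ^ 120 :=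
  natAbs_add_lt120 ((natAbs_sval_le σ i).trans (by norm_num))
    ((natAbs_le_of_mem_lamG hQ).trans (by norm_num))

/-- THE POTENTIAL as a function on `ℚ`: `Φ(v) = psiZ(2^25 v)/2^25`. [cell, gemm.tex §Regimes] -/
def psiG (v : ℚ) : ℚ := (psiZ ⌊v * 2 ^ 25⌋ : ℚ) / 2 ^ 25

/-- `Φ(V/2^25) = psiZ V / 2^25`. [cell] -/
theorem psiG_dyadic (V : ℤ) : psiG ((V : ℚ) / 2 ^ 25) = (psiZ V : ℚ) / 2 ^ 25 := by
  unfold psiG; rw [div_mul_cancel₀ (V : ℚ) (by norm_num : (2 : ℚ) ^ 25 ≠ 0), Int.floor_intCast]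

/-- THE STATE SET: `± valG i / 2^25`, `i ≤ 6656`. [cell, gemm.tex §Regimes] -/
def SG (v : ℚ) : Prop := ∃ σ : Bool, ∃ i : ℕ, i ≤ 6656 ∧ v = (sval σ i : ℚ) / 2 ^ 25

/-- A recognised magnitude is a state. [cell] -/
theorem SG_of_idx {W : ℤ} (h1 : idxG W.natAbs ≤ 6656) (h2 : valG (idxG W.natAbs) = W.natAbs) :
    SG ((W : ℚ) / 2 ^ 25) := by
  refine ⟨decide (W < 0), idxG W.natAbs, h1, ?_⟩
  have : sval (decide (W < 0)) (idxG W.natAbs) = W := by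
    unfold sval; rw [h2]
    by_cases hW : W < 0
    · simp only [hW, decide_true, if_true]; omega
    · simp only [hW, decide_false, Bool.false_eq_true, if_false]; omega
  rw [this]

/-- A state is a `bfloat16` datum. [cell] -/
theorem exists_toRat_eq_sval (σ : Bool) {i : ℕ} (hi : i ≤ 6656) :
    ∃ y : MiniFloat Format.BFloat16, y.toRat = (sval σ i : ℚ) / 2 ^ 25 := by
  have hb : (sval σ i - ((qlo σ i : ℕ) : ℤ)).natAbs < 2 ^ 120 := by
    have := natAbs_sval_le σ i; have := (qlo_le_qhi_le σ i).1; omega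
  obtain ⟨y, hy⟩ := exists_toRat_eq_rne8_dyadic120 g25 _ hb
  exact ⟨y, by rw [hy, sval_eq_rne8 σ hi]⟩

/-- LEMMA D IN GRID UNITS: the move after a free move is paid (`d' > 0`). [cell, GemmFreeMoves] -/
theorem second_move_paid (σ : Bool) {i : ℕ} (hi : i ≤ 6656) {Q Q' : ℤ} (hQ : Q ∈ lamG)
    (hQ' : Q' ∈ lamG) (hne : WQ σ i Q ≠ sval σ i) (hd0 : defQ σ i Q = 0) {τ : Bool} {j : ℕ}
    (hW : WQ σ i Q = sval τ j) (hne2 : WQ τ j Q' ≠ sval τ j) : 0 < defQ τ j Q' := by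
  have h225 : (0 : ℚ) < 2 ^ 25 := by positivity
  obtain ⟨y, hy⟩ := exists_toRat_eq_sval σ hi
  have hb := hb120 hQ σ i
  have hb' := hb120 hQ' τ j
  unfold WQ at hW hne hne2
  have e1 : (roundNE Format.BFloat16 (y.toRat + (Q : ℚ) / 2 ^ 25)).toRat = (sval τ j : ℚ) / 2 ^ 25 := by
    have := flStep_dyadic120 g25 hb
    unfold flStep at this
    rw [hy, this, hW]
  have e2 : (roundNE Format.BFloat16 ((sval τ j : ℚ) / 2 ^ 25 + (Q' : ℚ) / 2 ^ 25)).toRat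
      = (rne8 (sval τ j + Q') : ℚ) / 2 ^ 25 := by
    have := flStep_dyadic120 g25 hb'
    unfold flStep at this
    exact this
  have hm : 1 ≤ Format.BFloat16.manBits := by rw [BFloat16_manBits]; norm_num
  have hδ : sval τ j - (sval σ i + Q) = (Q.natAbs : ℤ) := by
    unfold defQ gainQ WQ at hd0; rw [hW] at hd0; omega
  have hlt := no_consecutive_free_moves hm y ((Q : ℚ) / 2 ^ 25) ((Q' : ℚ) / 2 ^ 25)
    (by rw [e1, hy]; intro h; exact hne (hW.trans (dyadic_eq_iff.mp h)))
    (by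
      rw [e1, hy, abs_div, abs_of_pos h225, ← Int.cast_abs, ← Int.natCast_natAbs, ← add_div,
        ← sub_div, ← hδ]
      push_cast; ring)
    (by rw [e1, e2]; intro h; exact hne2 (dyadic_eq_iff.mp h))
  rw [e1, e2, abs_div, abs_of_pos h225, ← Int.cast_abs, ← Int.natCast_natAbs, ← add_div, ← sub_div,
    div_lt_div_iff_of_pos_right h225] at hlt
  have h' : rne8 (sval τ j + Q') - (sval τ j + Q') < (Q'.natAbs : ℤ) := by exact_mod_cast hlt
  unfold defQ gainQ WQ
  omega

end ThetaE4M3E5M2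

/-- THE ALPHABET: the `2085` products `E4M3 · E5M2` as rationals (grid `2^-25`).
[cell, gemm.tex §Regimes; MicikeviciusEtAl2022 Table 1 for the value set] -/
def piE4M3E5M2 : List ℚ := lamG.map fun Q : ℤ => (Q : ℚ) / 2 ^ 25

/-- Every letter of `piE4M3E5M2` is `Q/2^25` with `Q ∈ lamG`. [cell] -/
theorem exists_of_mem_piE4M3E5M2 {q : ℚ} (hq : q ∈ piE4M3E5M2) : ∃ Q ∈ lamG, (Q : ℚ) / 2 ^ 25 = q :=
  List.mem_map.mp hq

/-! ### The certificate -/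

/-- THE θ-CERTIFICATE OF E4M3·E5M2→bfloat16 (RNE, sequential): letters `piE4M3E5M2`, states `SG`, potential
`psiG`, `θ = 558345748481/274877906944`, `ρ = 63/2`, `β_pair = 193/2`,
`κ = 274877906944/558345748481`.
[cell certificate, kernel-checked; gemm.tex §Regimes Prop. Θ(i)] -/
theorem thetaCert_E4M3E5M2_BFloat16 :
    ThetaCertificate Format.BFloat16 (fun q => q ∈ piE4M3E5M2) SG psiG
      (558345748481 / 274877906944) (63 / 2) (193 / 2)
      (274877906944 / 558345748481) where
  θ_pos := by norm_num
  ρ_nonneg := by norm_num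
  βp_nonneg := by norm_num
  κ_nonneg := by norm_num
  start := by
    intro q hq
    obtain ⟨Q, hQ, rfl⟩ := exists_of_mem_piE4M3E5M2 hq
    have hb : Q.natAbs < 2 ^ 120 := by have := natAbs_le_of_mem_lamG hQ; norm_num; omega
    have hs := List.all_eq_true.mp starts_all.1 Q hQ
    unfold startOK at hs
    simp only [Bool.and_eq_true, decide_eq_true_eq] at hs
    obtain ⟨⟨⟨⟨h0, h1⟩, h2⟩, h3⟩, -⟩ := hs
    refine ⟨?_, SG_of_idx h1 h2, ?_⟩
    · obtain ⟨y, hy⟩ := exists_toRat_eq_rne8_dyadic120 g25 Q hb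
      exact ⟨y, by rw [hy, h0]⟩
    · rw [psiG_dyadic, abs_div, abs_of_pos (by positivity : (0 : ℚ) < 2 ^ 25), ← Int.cast_abs,
        ← Int.natCast_natAbs]
      have : ((psiZ Q : ℤ) : ℚ) ≤ ((Q.natAbs : ℤ) : ℚ) := by exact_mod_cast h3
      exact div_le_div_of_nonneg_right (by exact_mod_cast this) (by positivity)
  closed := by
    rintro v q ⟨σ, i, hi, rfl⟩ hq
    obtain ⟨Q, hQ, rfl⟩ := exists_of_mem_piE4M3E5M2 hq
    rw [flStep_dyadic120 g25 (hb120 hQ σ i)]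
    obtain ⟨τ, j, hj, hW⟩ := isSt_WQ σ hQ i
    unfold WQ at hW
    exact ⟨τ, j, hj, by rw [hW]⟩
  potential := by
    rintro v q ⟨σ, i, hi, rfl⟩ hq hne
    obtain ⟨Q, hQ, rfl⟩ := exists_of_mem_piE4M3E5M2 hq
    have hb := hb120 hQ σ i
    rw [flStep_dyadic120 g25 hb] at hne ⊢
    rw [psiG_dyadic, psiG_dyadic, deficitOf_dyadic120 g25 hb]
    have hne' : WQ σ i Q ≠ sval σ i := fun h => hne (by unfold WQ at h; rw [h])
    obtain ⟨h3, -⟩ := (edge_facts σ hi hQ).2 hne'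
    unfold defQ gainQ WQ at h3
    have h3' : ((psiZ (rne8 (sval σ i + Q)) : ℤ) : ℚ)
        ≤ ((psiZ (sval σ i) + ((Q.natAbs : ℤ) - (rne8 (sval σ i + Q) - sval σ i - Q)) : ℤ) : ℚ) := by
      exact_mod_cast h3
    push_cast at h3' ⊢
    linarith
  capacity := by
    rintro v q ⟨σ, i, hi, rfl⟩ hq habs hneg
    obtain ⟨Q, hQ, rfl⟩ := exists_of_mem_piE4M3E5M2 hq
    have hb := hb120 hQ σ i
    rw [flStep_dyadic120 g25 hb, dyadic_eq_iff] at habs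
    have hQ0 : Q < 0 := by
      have : (Q : ℚ) < 0 := by
        have h2 : (0 : ℚ) < 2 ^ 25 := by positivity
        by_contra hc; push Not at hc
        exact absurd hneg (not_lt.mpr (div_nonneg hc h2.le))
      exact_mod_cast this
    rw [psiG_dyadic]
    have h := (edge_facts σ hi hQ).1 habs hQ0
    have h' : ((558345748481 * -Q : ℤ) : ℚ) ≤ ((274877906944 * psiZ (sval σ i) : ℤ) : ℚ) := by
      exact_mod_cast h
    push_cast at h'
    rw [show (558345748481 : ℚ) / 274877906944 * -((Q : ℚ) / 2 ^ 25)
        = 558345748481 * -(Q : ℚ) / 274877906944 / 2 ^ 25 by ring]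
    exact div_le_div_of_nonneg_right (by linarith) (by positivity)
  paid := by
    rintro v q ⟨σ, i, hi, rfl⟩ hq hne hpos
    obtain ⟨Q, hQ, rfl⟩ := exists_of_mem_piE4M3E5M2 hq
    have hb := hb120 hQ σ i
    have h225 : (0 : ℚ) < 2 ^ 25 := by positivity
    rw [flStep_dyadic120 g25 hb] at hne
    rw [deficitOf_dyadic120 g25 hb] at hpos ⊢
    rw [gainOf_dyadic120 g25 hb]
    have hne' : WQ σ i Q ≠ sval σ i := fun h => hne (by unfold WQ at h; rw [h])
    have hpos' : 0 < defQ σ i Q := by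
      have : (0 : ℚ) < (((Q.natAbs : ℤ) - (rne8 (sval σ i + Q) - sval σ i - Q) : ℤ) : ℚ) := by
        by_contra hc; push Not at hc
        exact absurd hpos (not_lt.mpr (div_nonpos_of_nonpos_of_nonneg hc h225.le))
      unfold defQ gainQ WQ
      exact_mod_cast this
    obtain ⟨-, hmv⟩ := (edge_facts σ hi hQ).2 hne'
    rcases hmv with ⟨-, h⟩ | ⟨hd, -, -⟩
    · unfold defQ gainQ WQ at h
      have h' : ((2 * (rne8 (sval σ i + Q) - sval σ i - Q) : ℤ) : ℚ)
          ≤ ((63 * ((Q.natAbs : ℤ) - (rne8 (sval σ i + Q) - sval σ i - Q)) : ℤ) : ℚ) := by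
        exact_mod_cast h
      push_cast at h' ⊢
      rw [← mul_div_assoc, div_le_div_iff_of_pos_right h225]
      linarith
    · exact absurd hpos' hd
  free := by
    rintro v q ⟨σ, i, hi, rfl⟩ hq hne hd0
    obtain ⟨Q, hQ, rfl⟩ := exists_of_mem_piE4M3E5M2 hq
    have hb := hb120 hQ σ i
    have h225 : (0 : ℚ) < 2 ^ 25 := by positivity
    rw [flStep_dyadic120 g25 hb] at hne ⊢
    rw [deficitOf_dyadic120 g25 hb] at hd0
    rw [gainOf_dyadic120 g25 hb, psiG_dyadic]
    have hne' : WQ σ i Q ≠ sval σ i := fun h => hne (by unfold WQ at h; rw [h])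
    have hd0' : defQ σ i Q = 0 := by
      have : ((((Q.natAbs : ℤ) - (rne8 (sval σ i + Q) - sval σ i - Q)) : ℤ) : ℚ) = 0 := by
        rcases div_eq_zero_iff.mp hd0 with h | h
        · exact h
        · exact absurd h (ne_of_gt h225)
      unfold defQ gainQ WQ
      exact_mod_cast this
    obtain ⟨-, hmv⟩ := (edge_facts σ hi hQ).2 hne'
    rcases hmv with ⟨hd, -⟩ | ⟨-, hκ, haux⟩
    · rw [hd0'] at hd; exact absurd hd (lt_irrefl 0)
    obtain ⟨τ, j, hj, hW, hδ⟩ := freeAux_sound haux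
    refine ⟨?_, ?_⟩
    · unfold gainQ WQ at hκ
      have h' : ((558345748481 * (rne8 (sval σ i + Q) - sval σ i - Q) : ℤ) : ℚ)
          ≤ ((274877906944 * psiZ (sval σ i) : ℤ) : ℚ) := by exact_mod_cast hκ
      push_cast at h' ⊢
      rw [← mul_div_assoc, div_le_div_iff_of_pos_right h225]
      linarith
    · intro q' hq' hne2
      obtain ⟨Q', hQ', rfl⟩ := exists_of_mem_piE4M3E5M2 hq'
      have hWZ : rne8 (sval σ i + Q) = sval τ j := hW
      rw [hWZ] at hne2 ⊢
      have hb' := hb120 hQ' τ j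
      rw [flStep_dyadic120 g25 hb'] at hne2
      rw [gainOf_dyadic120 g25 hb', deficitOf_dyadic120 g25 hb']
      have hne2' : WQ τ j Q' ≠ sval τ j := fun h => hne2 (by unfold WQ at h; rw [h])
      have hd' := second_move_paid σ hi hQ hQ' hne' hd0' hW hne2'
      obtain ⟨-, hmv'⟩ := (edge_facts τ hj hQ').2 hne2'
      rcases hmv' with ⟨-, hpaid'⟩ | ⟨hnd, -, -⟩
      · have key := free_pair_bound hj hδ hne2' hpaid'
        unfold defQ gainQ WQ at key
        rw [hWZ] at key
        have h' : ((2 * ((sval τ j - sval σ i - Q) + (rne8 (sval τ j + Q') - sval τ j - Q')) : ℤ) : ℚ)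
            ≤ ((193 * ((Q'.natAbs : ℤ) - (rne8 (sval τ j + Q') - sval τ j - Q')) - 2 : ℤ) : ℚ) := by
          exact_mod_cast key
        push_cast at h' ⊢
        rw [← add_div, ← mul_div_assoc, div_le_div_iff_of_pos_right h225]
        linarith
      · exact absurd hd' hnd

end MiniFloat

end Literature.ComputerArithmetic.FloatingPoint
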